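import Mathlib
import HarnessLib
import Summits.Ventures.LatticeQCDFlow.Exactness.NCMCGeneralSpaceReplicaVectorCLTChains
import Summits.Ventures.LatticeQCDFlow.Exactness.NCMCGeneralSpaceReplicaTStatistic

/-!
# The replica `t`-statistic of `R ≥ 2` independent chains from ANY starts converges in law to `t(Z)`, `Z ~ N(0, σ²_f)^{⊗R}` (`σ²_f > 0`)

HONEST FRAMING: exact (Metropolis-corrected) sampling algorithms for lattice gauge theory;
figures of merit are autocorrelation/cost numbers at stated couplings and volumes; no
continuum-physics claim.

Venture `LatticeQCDFlow` (cell pub-lqcd), topic `Exactness`; FANOUT row 13 (`eng-snf`, GEN-23, replica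
pooling).  NEW WORK of the cell (composition of the cell's replica-vector CLT
`tendstoInDistribution_replicaVector_of_nHit` with the cell's a.e.-continuous mapping theorem for the
studentised mean, `tendstoInDistribution_tStat_of_pi_gaussianReal'`); not a published result; no
definition is introduced; nothing is cited as a fact (the Student-`t_{R−1}` calibration of the
"many short chains" / replica-jackknife error bar is NAMED ONLY).

WHY (row 13).  `latflow-snf`'s `estimators.free_energy` prints a replica / block jackknife bar, i.e. it
studentises the pooled mean by the SPREAD of the `R` replica means.  At fixed `R` that spread does not
converge to a constant (`NCMCGeneralSpaceReplicaVectorCLT`); what DOES hold — typed here — is that the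
studentised statistic
`t_n = ((1/R) Σ_r ȳ_{r,n} − πf) / √(Σ_r (ȳ_{r,n} − ȳ̄_n)² / (R(R−1)))`
of `R ≥ 2` independent restart/NCMC chains started from ANY laws converges in distribution to
`t(Z) = Z̄ / √(Σ_r (Z_r − Z̄)²/(R(R−1)))`, `Z ~ N(0, σ²_f)^{⊗R}`, whenever `σ²_f > 0` — so a `t_{R−1}`
quantile (not a normal one) is the right calibration of that bar, uniformly in the starts.

## Content
* `tStat_replicaVector_eq` — `t` of `((√n)⁻¹ Σ_{t<n} (y_{r,t} − θ))_r` is the studentised pooled mean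
  (scale invariance), every `n`.
* **`tendstoInDistribution_replicaTStat_of_nHit`** — the statement above (`κ` Markov, `π` invariant,
  `(nHit κ m)(z, ·) ≥ ε ν`, `ε ≠ 0`, `0 < m`, `|f| ≤ C`, `σ²_f > 0`, `R ≥ 2`, any starts `μ_r`).

NOT CLAIMED: the identification of the limit with Student's `t_{R−1}`; coverage of the printed interval
(needs the limit law not to charge the endpoints); anything numerical.
-/

namespace Summit.Ventures.LatticeQCDFlow.Exactness.GeneralNCMC

open MeasureTheory ProbabilityTheory Filter Finset WithLp
open scoped ENNReal NNReal Topology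

/-! ## §1 `t` of the normalised replica vector is the studentised pooled mean -/

section Algebra

variable {ι : Type*} [Fintype ι] [Nonempty ι]

/-- **`t(((√n)⁻¹ Σ_{t<n} (y_{r,t} − θ))_r)` IS the studentised pooled mean of the replica time
averages** `((1/R) Σ_r ȳ_{r,n} − θ) / √(Σ_r (ȳ_{r,n} − ȳ̄_n)² / (R(R−1)))` — for every `n` (at `n = 0`
both sides are `0`): scale invariance (`tStat_mul_left`) and `tStat_sub_const`. -/
theorem tStat_replicaVector_eq (y : ι → ℕ → ℝ) (θ : ℝ) (n : ℕ) :
    (∑ r, (Real.sqrt n)⁻¹ * ∑ t ∈ range n, (y r t - θ)) / Fintype.card ι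
        / Real.sqrt ((∑ r, ((Real.sqrt n)⁻¹ * ∑ t ∈ range n, (y r t - θ)
            - (∑ r', (Real.sqrt n)⁻¹ * ∑ t ∈ range n, (y r' t - θ)) / Fintype.card ι) ^ 2)
            / ((Fintype.card ι : ℝ) * (Fintype.card ι - 1)))
      = ((∑ r, (∑ t ∈ range n, y r t) / n) / Fintype.card ι - θ)
        / Real.sqrt ((∑ r, ((∑ t ∈ range n, y r t) / n
            - (∑ r', (∑ t ∈ range n, y r' t) / n) / Fintype.card ι) ^ 2)
            / ((Fintype.card ι : ℝ) * (Fintype.card ι - 1))) := by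
  rcases Nat.eq_zero_or_pos n with hn | hn
  · subst hn
    simp
  · have hn' : (0 : ℝ) < n := by exact_mod_cast hn
    have hc : 0 < (Real.sqrt n)⁻¹ * n := mul_pos (inv_pos.2 (Real.sqrt_pos.2 hn')) hn'
    have hkey : ∀ r, (Real.sqrt n)⁻¹ * ∑ t ∈ range n, (y r t - θ)
        = ((Real.sqrt n)⁻¹ * n) * ((∑ t ∈ range n, y r t) / n - θ) := by
      intro r
      rw [sum_sub_distrib, sum_const, card_range, nsmul_eq_mul, mul_assoc]
      congr 1
      rw [mul_sub, mul_div_cancel₀ _ hn'.ne']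
    simp_rw [hkey]
    have h1 := tStat_mul_left (ι := ι) (fun r => (∑ t ∈ range n, y r t) / (n : ℝ) - θ) hc
    have h2 := tStat_sub_const (ι := ι) (fun r => (∑ t ∈ range n, y r t) / (n : ℝ)) θ
    beta_reduce at h1 h2
    rw [h1, h2]

end Algebra

/-! ## §2 Chains: `t_n ⇒ t(Z)` from every family of starts -/

section Chains

variable {S : Type*} [MeasurableSpace S]
  {κ : Kernel S S} [IsMarkovKernel κ] {π : Measure S} [IsProbabilityMeasure π]
  {ν : Measure S} [IsProbabilityMeasure ν] {ε : ℝ≥0∞} {m : ℕ}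
  {ι : Type*} [Fintype ι] [Nontrivial ι]

/-- **THE REPLICA `t`-STATISTIC CONVERGES IN LAW TO `t(Z)`, `Z ~ N(0, σ²_f)^{⊗R}`, FROM EVERY FAMILY OF
STARTS.**  `κ` Markov, `π` invariant, `(nHit κ m)(z, ·) ≥ ε ν` (`ε ≠ 0`, `0 < m`), `|f| ≤ C`,
`σ²_f = c_f(0) + 2 Σ_{t≥1} c_f(t) > 0`, `R = |ι| ≥ 2` independent chains with initial laws `μ_r`.  Then
`((1/R) Σ_r ȳ_{r,n} − πf) / √(Σ_r (ȳ_{r,n} − ȳ̄_n)²/(R(R−1))) ⇒ Z̄ / √(Σ_r (Z_r − Z̄)²/(R(R−1)))`. -/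
theorem tendstoInDistribution_replicaTStat_of_nHit (hπ : Kernel.Invariant κ π) (hε : ε ≠ 0)
    (hmin : ∀ z, ε • ν ≤ nHit κ m z) (hm : 0 < m)
    {f : S → ℝ} (hf : Measurable f) {C : ℝ} (hC : ∀ x, |f x| ≤ C)
    (hσ : 0 < Scoring.autocov κ π (fun y => f y - ∫ z, f z ∂π) 0
          + 2 * ∑' t, Scoring.autocov κ π (fun y => f y - ∫ z, f z ∂π) (t + 1))
    (μ : ι → Measure S) [∀ r, IsProbabilityMeasure (μ r)]
    [∀ r, IsProbabilityMeasure (Kernel.trajMeasure (X := fun _ : ℕ => S) (μ r)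
        (fun n : ℕ => κ.comap (fun hh : (i : ↥(Finset.Iic n)) → S => hh ⟨n, Finset.mem_Iic.2 le_rfl⟩)
          (measurable_pi_apply _)))] :
    TendstoInDistribution (fun (n : ℕ) (x : ι → ℕ → S) =>
        ((∑ r, (∑ t ∈ range n, f (x r t)) / n) / Fintype.card ι - ∫ z, f z ∂π)
          / Real.sqrt ((∑ r, ((∑ t ∈ range n, f (x r t)) / n
              - (∑ r', (∑ t ∈ range n, f (x r' t)) / n) / Fintype.card ι) ^ 2)
              / ((Fintype.card ι : ℝ) * (Fintype.card ι - 1))))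
      atTop
      (fun z : ι → ℝ => (∑ r, z r) / Fintype.card ι
        / Real.sqrt ((∑ r, (z r - (∑ r', z r') / Fintype.card ι) ^ 2)
            / ((Fintype.card ι : ℝ) * (Fintype.card ι - 1))))
      (fun _ => Measure.pi fun r => Kernel.trajMeasure (X := fun _ : ℕ => S) (μ r)
        (fun n : ℕ => κ.comap (fun hh : (i : ↥(Finset.Iic n)) → S => hh ⟨n, Finset.mem_Iic.2 le_rfl⟩)
          (measurable_pi_apply _)))
      (Measure.pi fun _ : ι => gaussianReal 0 (Real.toNNReal
        (Scoring.autocov κ π (fun y => f y - ∫ z, f z ∂π) 0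
          + 2 * ∑' t, Scoring.autocov κ π (fun y => f y - ∫ z, f z ∂π) (t + 1)))) := by
  have hv : Real.toNNReal (Scoring.autocov κ π (fun y => f y - ∫ z, f z ∂π) 0
      + 2 * ∑' t, Scoring.autocov κ π (fun y => f y - ∫ z, f z ∂π) (t + 1)) ≠ 0 := by
    rw [ne_eq, Real.toNNReal_eq_zero, not_le]
    exact hσ
  have h := tendstoInDistribution_tStat_of_pi_gaussianReal' hv
    (tendstoInDistribution_replicaVector_of_nHit hπ hε hmin hm hf hC μ)
  have heq : (fun (n : ℕ) (x : ι → ℕ → S) =>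
        ((∑ r, (∑ t ∈ range n, f (x r t)) / n) / Fintype.card ι - ∫ z, f z ∂π)
          / Real.sqrt ((∑ r, ((∑ t ∈ range n, f (x r t)) / n
              - (∑ r', (∑ t ∈ range n, f (x r' t)) / n) / Fintype.card ι) ^ 2)
              / ((Fintype.card ι : ℝ) * (Fintype.card ι - 1))))
      = fun (n : ℕ) (x : ι → ℕ → S) =>
        (∑ r, (Real.sqrt n)⁻¹ * ∑ t ∈ range n, (f (x r t) - ∫ z, f z ∂π)) / Fintype.card ι
          / Real.sqrt ((∑ r, ((Real.sqrt n)⁻¹ * ∑ t ∈ range n, (f (x r t) - ∫ z, f z ∂π)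
              - (∑ r', (Real.sqrt n)⁻¹ * ∑ t ∈ range n, (f (x r' t) - ∫ z, f z ∂π))
                / Fintype.card ι) ^ 2)
              / ((Fintype.card ι : ℝ) * (Fintype.card ι - 1))) := by
    funext n x
    exact (tStat_replicaVector_eq (fun r t => f (x r t)) (∫ z, f z ∂π) n).symm
  rw [heq]
  exact h

end Chains

end Summit.Ventures.LatticeQCDFlow.Exactness.GeneralNCMC
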